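import Summits.QuantumFields.YangMills.Theorems.FlatTubeReductionCoreDefectOrbitMomentSq
import Summits.QuantumFields.YangMills.Theorems.FlatTubeReductionSlowFactorSqWeight
import HarnessLib

/-!
# The slow side of the `(C2)`-moments core bound, assembled: `∫_{orbitDist ≤ d_O} Φ(u, v) du`

Support file for the crux `NearFlatRatioLaw` (line `ratepack_v2`, stub `stub_hODpot_A`, step (R2b) of
`Cruxes/NearFlatRatioLaw/Lines/ratepack-v7-moments-g18.md`).

For the data `Φ` of `…CoreDefectOrbitMomentSq.defect_core_sq_integral_le_orbit_moments`, the slow integral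
`S(v) = ∫ 𝟙{orbitDist u ≤ d_O} Φ(u, v) du` is bounded by `…SlowFactorSqWeight.slow_factor_sq_weight_le` applied to the three slow weights
(`g₀`: `A(u) = 216βΓ·od u² + K_L(βA_L od u + √β/2)s + 3c₂s²`, `B(u) = 216βΓ·od u + K_LβA_L s`; `g₁`: `A(u) = K_L(βA_L od u + √β/2)`,
`B = K_LβA_L`; `1`), `s = min(‖x_v‖², R_in²)`: `slow_side_le` —
`S(v) ≤ [40(1+η_c)(𝒴₀(v)·Bnd₀(s) + (𝒴₁+𝒴₂)(v)·Bnd₁ + 9c₂²(𝒴₃+𝒴₄)(v)·2linkCE²‖φ‖²) + 2η_c² c_q a₀' e^{-q(x_v)}·2linkCE²‖φ‖²]/K₁(1,1)²`,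
each `Bnd = c·‖φ‖² + c'·∫orbitDist²φ²` with explicit window constants (polynomial in `s`, no logarithm).  Together with
`…FibreFactorReweighted.fibre_factor_moment_le_reweighted` (the `v`-integration of `e^{-q}‖x_v‖^{2a}𝒴_m(v)`), this leaves for `stub_hODpot_A`
only the reference-moment numbers and the record numerology.
-/

noncomputable section

open MeasureTheory Filter Topology Real
open scoped BigOperators
open Literature.MathematicalPhysics.QuantumFieldTheory
open Literature.MathematicalPhysics.QuantumLattice

namespace Summit.QuantumFields.YangMills.Theorems.FemtoTransferGap.TwoLattice.ConstTube

open Summit.QuantumFields.YangMills.Theorems.FemtoTransferGap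
open Summit.QuantumFields.YangMills.Theorems.FemtoTransferGap.TwoLattice
open Summit.QuantumFields.YangMills.Theorems.FemtoTransferGap.TwoLattice.Avg
open Summit.QuantumFields.YangMills.Theorems.FemtoTransferGap.TwoLattice.Stiff
open Summit.QuantumFields.YangMills.Theorems.FemtoTransferGap.TwoLattice.GnChart

variable {L : ℕ} [NeZero L]

/-! ## §1 The window inequalities for the two weights -/

/-- The `g₁` window inequalities: `(K(βA d + √β/2))² ≤ K²β/2 + 2K²β²A²·d²`. [folklore] -/
theorem g1_window {KL AL β d : ℝ} (hβ : 0 ≤ β) :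
    (KL * (β * (AL * d) + Real.sqrt β / 2)) ^ 2 ≤ KL ^ 2 * β / 2 + 2 * KL ^ 2 * β ^ 2 * AL ^ 2 * d ^ 2 := by
  have h : (β * (AL * d) + Real.sqrt β / 2) ^ 2 ≤ 2 * (β * (AL * d)) ^ 2 + 2 * (Real.sqrt β / 2) ^ 2 := by
    nlinarith [sq_nonneg (β * (AL * d) - Real.sqrt β / 2)]
  have hs : Real.sqrt β ^ 2 = β := Real.sq_sqrt hβ
  have e : (KL * (β * (AL * d) + Real.sqrt β / 2)) ^ 2 = KL ^ 2 * (β * (AL * d) + Real.sqrt β / 2) ^ 2 := by ring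
  rw [e]
  have h2 : (β * (AL * d) + Real.sqrt β / 2) ^ 2 ≤ 2 * (β ^ 2 * AL ^ 2 * d ^ 2) + β / 2 := by nlinarith
  nlinarith [sq_nonneg KL]

/-- The `g₀` window inequalities for `A(u) = 216βΓ d² + K(βA d + √β/2)s + 3c₂s²` (`0 ≤ d ≤ d_O`). [folklore] -/
theorem g0_windowA {KL AL β Γ c₂ s d dO : ℝ} (hβ : 0 ≤ β) (hd0 : 0 ≤ d) (hd : d ≤ dO) :
    (216 * β * Γ * d ^ 2 + KL * (β * (AL * d) + Real.sqrt β / 2) * s + 3 * c₂ * s ^ 2) ^ 2 ≤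
      (3 / 2 * KL ^ 2 * β * s ^ 2 + 27 * c₂ ^ 2 * s ^ 4) + (3 * (216 * β * Γ) ^ 2 * dO ^ 2 + 6 * KL ^ 2 * β ^ 2 * AL ^ 2 * s ^ 2) * d ^ 2 := by
  have h3 : (216 * β * Γ * d ^ 2 + KL * (β * (AL * d) + Real.sqrt β / 2) * s + 3 * c₂ * s ^ 2) ^ 2 ≤
      3 * ((216 * β * Γ * d ^ 2) ^ 2 + (KL * (β * (AL * d) + Real.sqrt β / 2) * s) ^ 2 + (3 * c₂ * s ^ 2) ^ 2) := by
    nlinarith [sq_nonneg (216 * β * Γ * d ^ 2 - KL * (β * (AL * d) + Real.sqrt β / 2) * s), sq_nonneg (KL * (β * (AL * d) + Real.sqrt β / 2) * s - 3 * c₂ * s ^ 2),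
      sq_nonneg (216 * β * Γ * d ^ 2 - 3 * c₂ * s ^ 2)]
  have hg := g1_window (KL := KL) (AL := AL) (d := d) hβ
  have h1 : (216 * β * Γ * d ^ 2) ^ 2 ≤ (216 * β * Γ) ^ 2 * dO ^ 2 * d ^ 2 := by
    have hdd : d ^ 2 ≤ dO ^ 2 := pow_le_pow_left₀ hd0 hd 2
    nlinarith [sq_nonneg (216 * β * Γ * d), mul_le_mul_of_nonneg_left hdd (mul_nonneg (sq_nonneg (216 * β * Γ)) (sq_nonneg d))]
  have h2 : (KL * (β * (AL * d) + Real.sqrt β / 2) * s) ^ 2 ≤ (KL ^ 2 * β / 2 + 2 * KL ^ 2 * β ^ 2 * AL ^ 2 * d ^ 2) * s ^ 2 := by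
    rw [mul_pow]; exact mul_le_mul_of_nonneg_right hg (sq_nonneg _)
  nlinarith

/-- … and for `B(u) = 216βΓ d + KβA s`. [folklore] -/
theorem g0_windowB (KL AL β Γ s d : ℝ) :
    (216 * β * Γ * d + KL * β * AL * s) ^ 2 ≤ 2 * KL ^ 2 * β ^ 2 * AL ^ 2 * s ^ 2 + 2 * (216 * β * Γ) ^ 2 * d ^ 2 := by
  nlinarith [sq_nonneg (216 * β * Γ * d - KL * β * AL * s)]

/-! ## §2 The slow side -/

set_option maxHeartbeats 1600000 in
-- three instantiations of `slow_factor_sq_weight_le` and the linearity bookkeeping on kilobyte-sized integrands.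
/-- ★★★ **THE SLOW SIDE, ASSEMBLED** (see the module docstring). [cite: Luscher1983, §3] -/
theorem slow_side_le {β : ℝ} (hβ1 : 1 ≤ β) {q : ℝ → LinkSpace L → ℝ}
    {Ω : LinkSpace L → ℝ} (hΩ0 : ∀ x, 0 ≤ Ω x) {W : (Site 3 L → SU2) → ℝ} (hW0 : ∀ g, 0 ≤ W g)
    {dO Rin Γ c₂ m : ℝ} (hΓ : 0 ≤ Γ) (hc₂ : 0 ≤ c₂) (hm : 0 ≤ m)
    {cq a₀' ηc : ℝ} (hcq : 0 ≤ cq) (ha₀' : 0 ≤ a₀') (hηc : 0 ≤ ηc)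
    {φ : GaugeConfig 3 1 SU2 → ℝ} (hφm : Measurable φ) {Cφ : ℝ} (hφb : ∀ u, |φ u| ≤ Cφ) (v : Edge 3 L → Fin 3 → ℝ) :
    ∫ u, {u : GaugeConfig 3 1 SU2 | orbitDist u ≤ dO}.indicator (fun _ => (1 : ℝ)) u *
        ((∫ w, φ w ^ 2 * (avgKernel ((L : ℝ) ^ 3 * β) u w / transferKernel su2Rep ((L : ℝ) ^ 3 * β) (1 : GaugeConfig 3 1 SU2) 1) ∂configMeasure SU2 1) *
              (40 * (1 + ηc) *
                  ((∫ w, (216 * β * (orbitDist u + orbitDist w) * orbitDist u * Γ +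
                    300000000 * ((Fintype.card (Edge 3 L) : ℝ) + (Fintype.card (Plaquette 3 L × Fin 3) : ℝ) + (Fintype.card (Plaquette 3 L) : ℝ)) *
                        (β * ((4 + Real.sqrt (8 * (Fintype.card (Plaquette 3 1) : ℝ) * (L : ℝ) ^ 3)) * (orbitDist u + orbitDist w)) + Real.sqrt β / 2) * min (‖linkEmbed L v‖ ^ 2) (Rin ^ 2) +
                    3 * c₂ * (min (‖linkEmbed L v‖ ^ 2) (Rin ^ 2)) ^ 2) ^ 2 * (avgKernel ((L : ℝ) ^ 3 * β) u w / transferKernel su2Rep ((L : ℝ) ^ 3 * β) (1 : GaugeConfig 3 1 SU2) 1) ∂configMeasure SU2 1) *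
                    (∫ c, fpFibreTransfer L β Ω W (gaugeTransform (fun _ : Site 3 L => c⁻¹) (orthoTube L 1 v)) 1 ∂haarProbability SU2) +
                  (∫ w, (300000000 * ((Fintype.card (Edge 3 L) : ℝ) + (Fintype.card (Plaquette 3 L × Fin 3) : ℝ) + (Fintype.card (Plaquette 3 L) : ℝ)) *
                        (β * ((4 + Real.sqrt (8 * (Fintype.card (Plaquette 3 1) : ℝ) * (L : ℝ) ^ 3)) * (orbitDist u + orbitDist w)) + Real.sqrt β / 2)) ^ 2 * (avgKernel ((L : ℝ) ^ 3 * β) u w / transferKernel su2Rep ((L : ℝ) ^ 3 * β) (1 : GaugeConfig 3 1 SU2) 1) ∂configMeasure SU2 1) *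
                    ((∫ c, fpFibreTransfer L β (fun x => Ω x * (‖x‖ ^ 2) ^ 2) W (gaugeTransform (fun _ : Site 3 L => c⁻¹) (orthoTube L 1 v)) 1 ∂haarProbability SU2) + (∫ c, fpFibreTransfer L β Ω (fun g => W g * (∑ x, ‖su2Quat (g x) - 1‖ ^ 2) ^ 2) (gaugeTransform (fun _ : Site 3 L => c⁻¹) (orthoTube L 1 v)) 1 ∂haarProbability SU2)) +
                  9 * c₂ ^ 2 * (∫ w, (avgKernel ((L : ℝ) ^ 3 * β) u w / transferKernel su2Rep ((L : ℝ) ^ 3 * β) (1 : GaugeConfig 3 1 SU2) 1) ∂configMeasure SU2 1) *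
                    ((∫ c, fpFibreTransfer L β (fun x => Ω x * (‖x‖ ^ 2) ^ 4) W (gaugeTransform (fun _ : Site 3 L => c⁻¹) (orthoTube L 1 v)) 1 ∂haarProbability SU2) + (∫ c, fpFibreTransfer L β Ω (fun g => W g * (∑ x, ‖su2Quat (g x) - 1‖ ^ 2) ^ 4) (gaugeTransform (fun _ : Site 3 L => c⁻¹) (orthoTube L 1 v)) 1 ∂haarProbability SU2))) +
                2 * ηc ^ 2 * (cq * (a₀' * Real.exp (-(q β (linkEmbed L v))))) * ∫ w, (avgKernel ((L : ℝ) ^ 3 * β) u w / transferKernel su2Rep ((L : ℝ) ^ 3 * β) (1 : GaugeConfig 3 1 SU2) 1) ∂configMeasure SU2 1)) ∂configMeasure SU2 1 ≤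
      (40 * (1 + ηc) *
            ((∫ c, fpFibreTransfer L β Ω W (gaugeTransform (fun _ : Site 3 L => c⁻¹) (orthoTube L 1 v)) 1 ∂haarProbability SU2) *
                (((((2 * (3 / 2 * (300000000 * ((Fintype.card (Edge 3 L) : ℝ) + (Fintype.card (Plaquette 3 L × Fin 3) : ℝ) + (Fintype.card (Plaquette 3 L) : ℝ))) ^ 2 * β * (min (‖linkEmbed L v‖ ^ 2) (Rin ^ 2)) ^ 2 + 27 * c₂ ^ 2 * (min (‖linkEmbed L v‖ ^ 2) (Rin ^ 2)) ^ 4) + 4 * (2 * (300000000 * ((Fintype.card (Edge 3 L) : ℝ) + (Fintype.card (Plaquette 3 L × Fin 3) : ℝ) + (Fintype.card (Plaquette 3 L) : ℝ))) ^ 2 * β ^ 2 * (4 + Real.sqrt (8 * (Fintype.card (Plaquette 3 1) : ℝ) * (L : ℝ) ^ 3)) ^ 2 * (min (‖linkEmbed L v‖ ^ 2) (Rin ^ 2)) ^ 2) * m ^ 2) * linkCE ((L : ℝ) ^ 3 * β) + 2 * (2 * (300000000 * ((Fintype.card (Edge 3 L) : ℝ) + (Fintype.card (Plaquette 3 L ×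 Fin 3) : ℝ) + (Fintype.card (Plaquette 3 L) : ℝ))) ^ 2 * β ^ 2 * (4 + Real.sqrt (8 * (Fintype.card (Plaquette 3 1) : ℝ) * (L : ℝ) ^ 3)) ^ 2 * (min (‖linkEmbed L v‖ ^ 2) (Rin ^ 2)) ^ 2) * ((4 * (Fintype.card (Edge 3 1) : ℝ)) ^ 2 * crossBound 1 ((L : ℝ) ^ 3 * β) m)) +
              2 * ((2 * (3 * (216 * β * Γ) ^ 2 * dO ^ 2 + 6 * (300000000 * ((Fintype.card (Edge 3 L) : ℝ) + (Fintype.card (Plaquette 3 L × Fin 3) : ℝ) + (Fintype.card (Plaquette 3 L) : ℝ))) ^ 2 * β ^ 2 * (4 + Real.sqrt (8 * (Fintype.card (Plaquette 3 1) : ℝ) * (L : ℝ) ^ 3)) ^ 2 * (min (‖linkEmbed L v‖ ^ 2) (Rin ^ 2)) ^ 2) + 4 * ((2 * (300000000 * ((Fintype.card (Edge 3 L) : ℝ) + (Fintype.card (Plaquette 3 L × Fin 3) : ℝ) + (Fintype.card (Plaquette 3 L) : ℝ))) ^ 2 * β ^ 2 * (4 + Real.sqrt (8 * (Fintype.card (Plaquette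 3 1) : ℝ) * (L : ℝ) ^ 3)) ^ 2 * (min (‖linkEmbed L v‖ ^ 2) (Rin ^ 2)) ^ 2) + (2 * (216 * β * Γ) ^ 2) * dO ^ 2 + (2 * (216 * β * Γ) ^ 2) * m ^ 2)) * linkCE ((L : ℝ) ^ 3 * β) + 2 * (2 * (216 * β * Γ) ^ 2) * ((4 * (Fintype.card (Edge 3 1) : ℝ)) ^ 2 * crossBound 1 ((L : ℝ) ^ 3 * β) m)) * m ^ 2) * linkCE ((L : ℝ) ^ 3 * β) +
            ((2 * (3 * (216 * β * Γ) ^ 2 * dO ^ 2 + 6 * (300000000 * ((Fintype.card (Edge 3 L) : ℝ) + (Fintype.card (Plaquette 3 L × Fin 3) : ℝ) + (Fintype.card (Plaquette 3 L) : ℝ))) ^ 2 * β ^ 2 * (4 + Real.sqrt (8 * (Fintype.card (Plaquette 3 1) : ℝ) * (L : ℝ) ^ 3)) ^ 2 * (min (‖linkEmbed L v‖ ^ 2) (Rin ^ 2)) ^ 2) + 4 * ((2 * (300000000 * ((Fintype.card (Edge 3 L) : ℝ) + (Fintype.card (Plaquette 3 L × Fin 3) : ℝ) + (Fintype.card (Plaquette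 3 L) : ℝ))) ^ 2 * β ^ 2 * (4 + Real.sqrt (8 * (Fintype.card (Plaquette 3 1) : ℝ) * (L : ℝ) ^ 3)) ^ 2 * (min (‖linkEmbed L v‖ ^ 2) (Rin ^ 2)) ^ 2) + (2 * (216 * β * Γ) ^ 2) * dO ^ 2 + (2 * (216 * β * Γ) ^ 2) * m ^ 2)) * linkCE ((L : ℝ) ^ 3 * β) + 2 * (2 * (216 * β * Γ) ^ 2) * ((4 * (Fintype.card (Edge 3 1) : ℝ)) ^ 2 * crossBound 1 ((L : ℝ) ^ 3 * β) m)) *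
              ((4 * (Fintype.card (Edge 3 1) : ℝ)) ^ 2 * crossBound 1 ((L : ℝ) ^ 3 * β) m)) * ∫ w, φ w ^ 2 ∂configMeasure SU2 1 +
          2 * ((2 * (3 * (216 * β * Γ) ^ 2 * dO ^ 2 + 6 * (300000000 * ((Fintype.card (Edge 3 L) : ℝ) + (Fintype.card (Plaquette 3 L × Fin 3) : ℝ) + (Fintype.card (Plaquette 3 L) : ℝ))) ^ 2 * β ^ 2 * (4 + Real.sqrt (8 * (Fintype.card (Plaquette 3 1) : ℝ) * (L : ℝ) ^ 3)) ^ 2 * (min (‖linkEmbed L v‖ ^ 2) (Rin ^ 2)) ^ 2) + 4 * ((2 * (300000000 * ((Fintype.card (Edge 3 L) : ℝ) + (Fintype.card (Plaquette 3 L × Fin 3) : ℝ) + (Fintype.card (Plaquette 3 L) : ℝ))) ^ 2 * β ^ 2 * (4 + Real.sqrt (8 * (Fintype.card (Plaquette 3 1) : ℝ) * (L : ℝ) ^ 3)) ^ 2 * (min (‖linkEmbed L v‖ ^ 2) (Rin ^ 2)) ^ 2) + (2 * (216 * β * Γ) ^ 2) * dO ^ 2 + (2 * (216 * β * Γ) ^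 2) * m ^ 2)) * linkCE ((L : ℝ) ^ 3 * β) + 2 * (2 * (216 * β * Γ) ^ 2) * ((4 * (Fintype.card (Edge 3 1) : ℝ)) ^ 2 * crossBound 1 ((L : ℝ) ^ 3 * β) m)) * linkCE ((L : ℝ) ^ 3 * β) *
            ∫ w, orbitDist w ^ 2 * φ w ^ 2 ∂configMeasure SU2 1) +
              ((∫ c, fpFibreTransfer L β (fun x => Ω x * (‖x‖ ^ 2) ^ 2) W (gaugeTransform (fun _ : Site 3 L => c⁻¹) (orthoTube L 1 v)) 1 ∂haarProbability SU2) + (∫ c, fpFibreTransfer L β Ω (fun g => W g * (∑ x, ‖su2Quat (g x) - 1‖ ^ 2) ^ 2) (gaugeTransform (fun _ : Site 3 L => c⁻¹) (orthoTube L 1 v)) 1 ∂haarProbability SU2)) *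
                (((((2 * (300000000 * ((Fintype.card (Edge 3 L) : ℝ) + (Fintype.card (Plaquette 3 L × Fin 3) : ℝ) + (Fintype.card (Plaquette 3 L) : ℝ))) ^ 2 * β / 2 + 4 * (300000000 * ((Fintype.card (Edge 3 L) : ℝ) + (Fintype.card (Plaquette 3 L × Fin 3) : ℝ) + (Fintype.card (Plaquette 3 L) : ℝ))) ^ 2 * β ^ 2 * (4 + Real.sqrt (8 * (Fintype.card (Plaquette 3 1) : ℝ) * (L : ℝ) ^ 3)) ^ 2 * m ^ 2) * linkCE ((L : ℝ) ^ 3 * β) + 2 * (300000000 * ((Fintype.card (Edge 3 L) : ℝ) + (Fintype.card (Plaquette 3 L × Fin 3) : ℝ) + (Fintype.card (Plaquette 3 L) : ℝ))) ^ 2 * β ^ 2 * (4 + Real.sqrt (8 * (Fintype.card (Plaquette 3 1) : ℝ) * (L : ℝ) ^ 3)) ^ 2 * ((4 * (Fintype.card (Edge 3 1) : ℝ)) ^ 2 * crossBound 1 ((L : ℝ) ^ 3 * β) m)) +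
              2 * ((2 * 2 * (300000000 * ((Fintype.card (Edge 3 L) : ℝ) + (Fintype.card (Plaquette 3 L × Fin 3) : ℝ) + (Fintype.card (Plaquette 3 L) : ℝ))) ^ 2 * β ^ 2 * (4 + Real.sqrt (8 * (Fintype.card (Plaquette 3 1) : ℝ) * (L : ℝ) ^ 3)) ^ 2 + 4 * ((300000000 * ((Fintype.card (Edge 3 L) : ℝ) + (Fintype.card (Plaquette 3 L × Fin 3) : ℝ) + (Fintype.card (Plaquette 3 L) : ℝ))) ^ 2 * β ^ 2 * (4 + Real.sqrt (8 * (Fintype.card (Plaquette 3 1) : ℝ) * (L : ℝ) ^ 3)) ^ 2 + 0 * dO ^ 2 + 0 * m ^ 2)) * linkCE ((L : ℝ) ^ 3 * β) + 2 * 0 * ((4 * (Fintype.card (Edge 3 1) : ℝ)) ^ 2 * crossBound 1 ((L : ℝ) ^ 3 * β) m)) * m ^ 2) * linkCE ((L : ℝ) ^ 3 * β) +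
            ((2 * 2 * (300000000 * ((Fintype.card (Edge 3 L) : ℝ) + (Fintype.card (Plaquette 3 L × Fin 3) : ℝ) + (Fintype.card (Plaquette 3 L) : ℝ))) ^ 2 * β ^ 2 * (4 + Real.sqrt (8 * (Fintype.card (Plaquette 3 1) : ℝ) * (L : ℝ) ^ 3)) ^ 2 + 4 * ((300000000 * ((Fintype.card (Edge 3 L) : ℝ) + (Fintype.card (Plaquette 3 L × Fin 3) : ℝ) + (Fintype.card (Plaquette 3 L) : ℝ))) ^ 2 * β ^ 2 * (4 + Real.sqrt (8 * (Fintype.card (Plaquette 3 1) : ℝ) * (L : ℝ) ^ 3)) ^ 2 + 0 * dO ^ 2 + 0 * m ^ 2)) * linkCE ((L : ℝ) ^ 3 * β) + 2 * 0 * ((4 * (Fintype.card (Edge 3 1) : ℝ)) ^ 2 * crossBound 1 ((L : ℝ) ^ 3 * β) m)) *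
              ((4 * (Fintype.card (Edge 3 1) : ℝ)) ^ 2 * crossBound 1 ((L : ℝ) ^ 3 * β) m)) * ∫ w, φ w ^ 2 ∂configMeasure SU2 1 +
          2 * ((2 * 2 * (300000000 * ((Fintype.card (Edge 3 L) : ℝ) + (Fintype.card (Plaquette 3 L × Fin 3) : ℝ) + (Fintype.card (Plaquette 3 L) : ℝ))) ^ 2 * β ^ 2 * (4 + Real.sqrt (8 * (Fintype.card (Plaquette 3 1) : ℝ) * (L : ℝ) ^ 3)) ^ 2 + 4 * ((300000000 * ((Fintype.card (Edge 3 L) : ℝ) + (Fintype.card (Plaquette 3 L × Fin 3) : ℝ) + (Fintype.card (Plaquette 3 L) : ℝ))) ^ 2 * β ^ 2 * (4 + Real.sqrt (8 * (Fintype.card (Plaquette 3 1) : ℝ) * (L : ℝ) ^ 3)) ^ 2 + 0 * dO ^ 2 + 0 * m ^ 2)) * linkCE ((L : ℝ) ^ 3 * β) + 2 * 0 * ((4 * (Fintype.card (Edge 3 1) : ℝ)) ^ 2 * crossBound 1 ((L : ℝ) ^ 3 * β) m)) * linkCE ((L : ℝ) ^ 3 * β) *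
            ∫ w, orbitDist w ^ 2 * φ w ^ 2 ∂configMeasure SU2 1) +
              9 * c₂ ^ 2 * ((∫ c, fpFibreTransfer L β (fun x => Ω x * (‖x‖ ^ 2) ^ 4) W (gaugeTransform (fun _ : Site 3 L => c⁻¹) (orthoTube L 1 v)) 1 ∂haarProbability SU2) + (∫ c, fpFibreTransfer L β Ω (fun g => W g * (∑ x, ‖su2Quat (g x) - 1‖ ^ 2) ^ 4) (gaugeTransform (fun _ : Site 3 L => c⁻¹) (orthoTube L 1 v)) 1 ∂haarProbability SU2)) *
                (2 * linkCE ((L : ℝ) ^ 3 * β) * linkCE ((L : ℝ) ^ 3 * β) * ∫ w, φ w ^ 2 ∂configMeasure SU2 1)) +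
          2 * ηc ^ 2 * (cq * (a₀' * Real.exp (-(q β (linkEmbed L v))))) * (2 * linkCE ((L : ℝ) ^ 3 * β) * linkCE ((L : ℝ) ^ 3 * β) * ∫ w, φ w ^ 2 ∂configMeasure SU2 1)) /
        transferKernel su2Rep ((L : ℝ) ^ 3 * β) (1 : GaugeConfig 3 1 SU2) 1 ^ 2 := by
  haveI : SecondCountableTopology SU2 := secondCountableTopology_su2
  -- names
  obtain ⟨B, hB⟩ : ∃ B : ℝ, B = (L : ℝ) ^ 3 * β := ⟨_, rfl⟩
  obtain ⟨K1, hK1⟩ : ∃ K1 : ℝ, K1 = transferKernel su2Rep B (1 : GaugeConfig 3 1 SU2) 1 := ⟨_, rfl⟩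
  obtain ⟨KL, hKL⟩ : ∃ KL : ℝ, KL = 300000000 * ((Fintype.card (Edge 3 L) : ℝ) + (Fintype.card (Plaquette 3 L × Fin 3) : ℝ) + (Fintype.card (Plaquette 3 L) : ℝ)) := ⟨_, rfl⟩
  obtain ⟨AL, hAL⟩ : ∃ AL : ℝ, AL = 4 + Real.sqrt (8 * (Fintype.card (Plaquette 3 1) : ℝ) * (L : ℝ) ^ 3) := ⟨_, rfl⟩
  obtain ⟨sv, hsv⟩ : ∃ sv : ℝ, sv = min (‖linkEmbed L v‖ ^ 2) (Rin ^ 2) := ⟨_, rfl⟩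
  rw [← hB]; rw [← hK1, ← hKL, ← hAL, ← hsv]
  have hβ : (0 : ℝ) ≤ β := by linarith
  have hB0 : 0 ≤ B := by rw [hB]; positivity
  have hK1p : 0 < K1 := by rw [hK1]; exact transferKernel_pos su2Rep _ _ _
  obtain ⟨hKL0, hAL0⟩ : 0 ≤ KL ∧ 0 ≤ AL := ⟨by rw [hKL]; positivity, by rw [hAL]; positivity⟩
  have hsv0 : 0 ≤ sv := by rw [hsv]; exact le_min (sq_nonneg _) (sq_nonneg _)
  obtain ⟨M, hM⟩ := exists_transferKernel_le su2Rep continuous_su2Rep B (L := 1)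
  have hMK : 0 ≤ M / K1 := div_nonneg ((transferKernel_pos su2Rep B (1 : GaugeConfig 3 1 SU2) 1).le.trans (hM 1 1)) hK1p.le
  have hρ0 : ∀ u w : GaugeConfig 3 1 SU2, 0 ≤ avgKernel B u w / K1 := fun u w => div_nonneg (avgKernel_pos B u w).le hK1p.le
  have hod0 : ∀ u : GaugeConfig 3 1 SU2, 0 ≤ orbitDist u ∧ orbitDist u ≤ 4 * (Fintype.card (Edge 3 1) : ℝ) := fun u => ⟨orbitDist_nonneg u, orbitDist_le_four_card u⟩
  have hE0 : (0 : ℝ) ≤ 4 * (Fintype.card (Edge 3 1) : ℝ) := by positivity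
  have hodm : Measurable (orbitDist (L := 1)) := measurable_orbitDist
  -- the fibre numbers (fixed `v`)
  obtain ⟨Y₀, hY₀⟩ : ∃ Y₀ : ℝ, Y₀ = ∫ c, fpFibreTransfer L β Ω W (gaugeTransform (fun _ : Site 3 L => c⁻¹) (orthoTube L 1 v)) 1 ∂haarProbability SU2 := ⟨_, rfl⟩
  obtain ⟨Y₁, hY₁⟩ : ∃ Y₁ : ℝ, Y₁ = ∫ c, fpFibreTransfer L β (fun x => Ω x * (‖x‖ ^ 2) ^ 2) W (gaugeTransform (fun _ : Site 3 L => c⁻¹) (orthoTube L 1 v)) 1 ∂haarProbability SU2 := ⟨_, rfl⟩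
  obtain ⟨Y₂, hY₂⟩ : ∃ Y₂ : ℝ, Y₂ = ∫ c, fpFibreTransfer L β Ω (fun g => W g * (∑ x, ‖su2Quat (g x) - 1‖ ^ 2) ^ 2) (gaugeTransform (fun _ : Site 3 L => c⁻¹) (orthoTube L 1 v)) 1
      ∂haarProbability SU2 := ⟨_, rfl⟩
  obtain ⟨Y₃, hY₃⟩ : ∃ Y₃ : ℝ, Y₃ = ∫ c, fpFibreTransfer L β (fun x => Ω x * (‖x‖ ^ 2) ^ 4) W (gaugeTransform (fun _ : Site 3 L => c⁻¹) (orthoTube L 1 v)) 1 ∂haarProbability SU2 := ⟨_, rfl⟩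
  obtain ⟨Y₄, hY₄⟩ : ∃ Y₄ : ℝ, Y₄ = ∫ c, fpFibreTransfer L β Ω (fun g => W g * (∑ x, ‖su2Quat (g x) - 1‖ ^ 2) ^ 4) (gaugeTransform (fun _ : Site 3 L => c⁻¹) (orthoTube L 1 v)) 1
      ∂haarProbability SU2 := ⟨_, rfl⟩
  obtain ⟨Ef, hEf⟩ : ∃ Ef : ℝ, Ef = cq * (a₀' * Real.exp (-(q β (linkEmbed L v)))) := ⟨_, rfl⟩
  rw [← hY₀, ← hY₁, ← hY₂, ← hY₃, ← hY₄, ← hEf]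
  have hΩk0 : ∀ (k : ℕ) (x : LinkSpace L), 0 ≤ Ω x * (‖x‖ ^ 2) ^ k := fun k x => mul_nonneg (hΩ0 x) (by positivity)
  have hWj0 : ∀ (j : ℕ) (g : Site 3 L → SU2), 0 ≤ W g * (∑ x, ‖su2Quat (g x) - 1‖ ^ 2) ^ j := fun j g => mul_nonneg (hW0 g) (pow_nonneg (gaugeDevSq_mem g).1 j)
  have hY₀0 : 0 ≤ Y₀ := by rw [hY₀]; exact integral_nonneg fun c => fpFibreTransfer_nonneg β hΩ0 hW0 _ _
  have hY₁0 : 0 ≤ Y₁ := by rw [hY₁]; exact integral_nonneg fun c => fpFibreTransfer_nonneg β (hΩk0 2) hW0 _ _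
  have hY₂0 : 0 ≤ Y₂ := by rw [hY₂]; exact integral_nonneg fun c => fpFibreTransfer_nonneg β hΩ0 (hWj0 2) _ _
  have hY₃0 : 0 ≤ Y₃ := by rw [hY₃]; exact integral_nonneg fun c => fpFibreTransfer_nonneg β (hΩk0 4) hW0 _ _
  have hY₄0 : 0 ≤ Y₄ := by rw [hY₄]; exact integral_nonneg fun c => fpFibreTransfer_nonneg β hΩ0 (hWj0 4) _ _
  have hEf0 : 0 ≤ Ef := by rw [hEf]; exact mul_nonneg hcq (mul_nonneg ha₀' (Real.exp_nonneg _))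
  -- the slow pieces
  obtain ⟨Af, hAf⟩ : ∃ Af : GaugeConfig 3 1 SU2 → ℝ, Af = fun u => ∫ w, φ w ^ 2 * (avgKernel B u w / K1) ∂configMeasure SU2 1 := ⟨_, rfl⟩
  obtain ⟨Rf, hRf⟩ : ∃ Rf : GaugeConfig 3 1 SU2 → ℝ, Rf = fun u => ∫ w, avgKernel B u w / K1 ∂configMeasure SU2 1 := ⟨_, rfl⟩
  obtain ⟨A₀, hA₀⟩ : ∃ A₀ : GaugeConfig 3 1 SU2 → ℝ, A₀ = fun u => 216 * β * Γ * orbitDist u ^ 2 + KL * (β * (AL * orbitDist u) + Real.sqrt β / 2) * sv + 3 * c₂ * sv ^ 2 := ⟨_, rfl⟩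
  obtain ⟨B₀, hB₀⟩ : ∃ B₀ : GaugeConfig 3 1 SU2 → ℝ, B₀ = fun u => 216 * β * Γ * orbitDist u + KL * β * AL * sv := ⟨_, rfl⟩
  obtain ⟨A₁, hA₁⟩ : ∃ A₁ : GaugeConfig 3 1 SU2 → ℝ, A₁ = fun u => KL * (β * (AL * orbitDist u) + Real.sqrt β / 2) := ⟨_, rfl⟩
  obtain ⟨G₀, hG₀⟩ : ∃ G₀ : GaugeConfig 3 1 SU2 → ℝ, G₀ = fun u => ∫ w, (A₀ u + B₀ u * orbitDist w) ^ 2 * (avgKernel B u w / K1) ∂configMeasure SU2 1 := ⟨_, rfl⟩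
  obtain ⟨G₁, hG₁⟩ : ∃ G₁ : GaugeConfig 3 1 SU2 → ℝ, G₁ = fun u => ∫ w, (A₁ u + KL * β * AL * orbitDist w) ^ 2 * (avgKernel B u w / K1) ∂configMeasure SU2 1 := ⟨_, rfl⟩
  obtain ⟨GR, hGR⟩ : ∃ GR : GaugeConfig 3 1 SU2 → ℝ, GR = fun u => ∫ w, ((1 : ℝ) + 0 * orbitDist w) ^ 2 * (avgKernel B u w / K1) ∂configMeasure SU2 1 := ⟨_, rfl⟩
  -- identification of the integrands of `Φ` with the pieces
  have eG₀ : ∀ u, ∫ w, (216 * β * (orbitDist u + orbitDist w) * orbitDist u * Γ + KL * (β * (AL * (orbitDist u + orbitDist w)) + Real.sqrt β / 2) * sv +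
      3 * c₂ * sv ^ 2) ^ 2 * (avgKernel B u w / K1) ∂configMeasure SU2 1 = G₀ u := fun u => by
    rw [hG₀, hA₀, hB₀]; exact integral_congr_ae (ae_of_all _ fun w => by ring)
  have eG₁ : ∀ u, ∫ w, (KL * (β * (AL * (orbitDist u + orbitDist w)) + Real.sqrt β / 2)) ^ 2 * (avgKernel B u w / K1) ∂configMeasure SU2 1 = G₁ u := fun u => by
    rw [hG₁, hA₁]; exact integral_congr_ae (ae_of_all _ fun w => by ring)
  have eGR : ∀ u, ∫ w, avgKernel B u w / K1 ∂configMeasure SU2 1 = GR u := fun u => by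
    rw [hGR]; exact integral_congr_ae (ae_of_all _ fun w => by ring)
  -- measurability and bounds of the pieces
  have hAfm : Measurable Af := by
    rw [hAf, hK1]; have h := measurable_integral_mul_avgRatio B (Y := GaugeConfig 3 1 SU2) measurable_id (H := fun z => φ z.2 ^ 2) ((hφm.comp measurable_snd).pow_const 2)
    simpa only [id] using h
  have hCφ0 : 0 ≤ Cφ := (abs_nonneg _).trans (hφb 1)
  have hφ2 : ∀ w, φ w ^ 2 ≤ Cφ ^ 2 := fun w => by rw [← sq_abs]; exact pow_le_pow_left₀ (abs_nonneg _) (hφb w) 2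
  have hAf0 : ∀ u, 0 ≤ Af u := fun u => by rw [hAf]; exact integral_nonneg fun w => mul_nonneg (sq_nonneg _) (hρ0 u w)
  have hAfb : ∀ u, Af u ≤ Cφ ^ 2 * (M / K1) := fun u => by rw [hAf, hK1]; exact integral_mul_avgRatio_le hM (fun w => sq_nonneg _) hφ2 u
  have hA₀m : Measurable A₀ := by
    rw [hA₀]; exact ((measurable_const.mul (hodm.pow_const 2)).add ((measurable_const.mul ((measurable_const.mul (measurable_const.mul hodm)).add measurable_const)).mul
      measurable_const)).add measurable_const
  have hB₀m : Measurable B₀ := by rw [hB₀]; exact (measurable_const.mul hodm).add measurable_const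
  have hA₁m : Measurable A₁ := by rw [hA₁]; exact measurable_const.mul ((measurable_const.mul (measurable_const.mul hodm)).add measurable_const)
  -- a generic bound for `∫ (a(u) + b(u)·od w)² ρ̄`
  have hGm : ∀ {a b : GaugeConfig 3 1 SU2 → ℝ}, Measurable a → Measurable b →
      Measurable fun u => ∫ w, (a u + b u * orbitDist w) ^ 2 * (avgKernel B u w / K1) ∂configMeasure SU2 1 := by
    intro a b ha hb
    rw [hK1]
    have h := measurable_integral_mul_avgRatio B (Y := GaugeConfig 3 1 SU2) measurable_id (H := fun z => (a z.1 + b z.1 * orbitDist z.2) ^ 2)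
      (((ha.comp measurable_fst).add ((hb.comp measurable_fst).mul (hodm.comp measurable_snd))).pow_const 2)
    simpa only [id] using h
  have hGb : ∀ {a b : GaugeConfig 3 1 SU2 → ℝ} {Ca Cb : ℝ}, (∀ u, |a u| ≤ Ca) → (∀ u, |b u| ≤ Cb) → ∀ u,
      0 ≤ ∫ w, (a u + b u * orbitDist w) ^ 2 * (avgKernel B u w / K1) ∂configMeasure SU2 1 ∧
        ∫ w, (a u + b u * orbitDist w) ^ 2 * (avgKernel B u w / K1) ∂configMeasure SU2 1 ≤ (Ca + Cb * (4 * (Fintype.card (Edge 3 1) : ℝ))) ^ 2 * (M / K1) := by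
    intro a b Ca Cb ha hb u
    refine ⟨integral_nonneg fun w => mul_nonneg (sq_nonneg _) (hρ0 u w), ?_⟩
    rw [hK1]
    refine integral_mul_avgRatio_le hM (fun w => sq_nonneg _) (fun w => ?_) u
    have h1 : |a u + b u * orbitDist w| ≤ Ca + Cb * (4 * (Fintype.card (Edge 3 1) : ℝ)) := by
      refine (abs_add_le _ _).trans (add_le_add (ha u) ?_)
      rw [abs_mul, abs_of_nonneg (hod0 w).1]
      exact mul_le_mul (hb u) (hod0 w).2 (hod0 w).1 ((abs_nonneg _).trans (hb u))
    have h0 : 0 ≤ Ca + Cb * (4 * (Fintype.card (Edge 3 1) : ℝ)) := (abs_nonneg _).trans h1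
    rw [← sq_abs]; exact pow_le_pow_left₀ (abs_nonneg _) h1 2
  have hA₀b : ∀ u, |A₀ u| ≤ 216 * β * Γ * (4 * (Fintype.card (Edge 3 1) : ℝ)) ^ 2 + KL * (β * (AL * (4 * (Fintype.card (Edge 3 1) : ℝ))) + Real.sqrt β / 2) * sv +
      3 * c₂ * sv ^ 2 := fun u => by
    rw [hA₀]; dsimp only
    have h0 : 0 ≤ 216 * β * Γ * orbitDist u ^ 2 + KL * (β * (AL * orbitDist u) + Real.sqrt β / 2) * sv + 3 * c₂ * sv ^ 2 :=
      add_nonneg (add_nonneg (mul_nonneg (mul_nonneg (mul_nonneg (by norm_num) hβ) hΓ) (sq_nonneg _))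
        (mul_nonneg (mul_nonneg hKL0 (add_nonneg (mul_nonneg hβ (mul_nonneg hAL0 (hod0 u).1)) (div_nonneg (Real.sqrt_nonneg _) two_pos.le))) hsv0))
        (mul_nonneg (mul_nonneg (by norm_num) hc₂) (sq_nonneg _))
    rw [abs_of_nonneg h0]
    have h1 : orbitDist u ^ 2 ≤ (4 * (Fintype.card (Edge 3 1) : ℝ)) ^ 2 := pow_le_pow_left₀ (hod0 u).1 (hod0 u).2 2
    have h2 := mul_le_mul_of_nonneg_left h1 (mul_nonneg (mul_nonneg (by norm_num : (0 : ℝ) ≤ 216) hβ) hΓ)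
    have h3 : KL * (β * (AL * orbitDist u) + Real.sqrt β / 2) * sv ≤ KL * (β * (AL * (4 * (Fintype.card (Edge 3 1) : ℝ))) + Real.sqrt β / 2) * sv :=
      mul_le_mul_of_nonneg_right (mul_le_mul_of_nonneg_left (add_le_add (mul_le_mul_of_nonneg_left (mul_le_mul_of_nonneg_left (hod0 u).2 hAL0) hβ) (le_refl (Real.sqrt β / 2))) hKL0) hsv0
    linarith
  have hB₀b : ∀ u, |B₀ u| ≤ 216 * β * Γ * (4 * (Fintype.card (Edge 3 1) : ℝ)) + KL * β * AL * sv := fun u => by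
    rw [hB₀]; dsimp only
    rw [abs_of_nonneg (add_nonneg (mul_nonneg (mul_nonneg (mul_nonneg (by norm_num) hβ) hΓ) (hod0 u).1) (mul_nonneg (mul_nonneg (mul_nonneg hKL0 hβ) hAL0) hsv0))]
    have h2 := mul_le_mul_of_nonneg_left (hod0 u).2 (mul_nonneg (mul_nonneg (by norm_num : (0 : ℝ) ≤ 216) hβ) hΓ)
    linarith
  have hA₁b : ∀ u, |A₁ u| ≤ KL * (β * (AL * (4 * (Fintype.card (Edge 3 1) : ℝ))) + Real.sqrt β / 2) := fun u => by
    rw [hA₁]; dsimp only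
    rw [abs_of_nonneg (mul_nonneg hKL0 (add_nonneg (mul_nonneg hβ (mul_nonneg hAL0 (hod0 u).1)) (div_nonneg (Real.sqrt_nonneg _) two_pos.le)))]
    exact mul_le_mul_of_nonneg_left (add_le_add (mul_le_mul_of_nonneg_left (mul_le_mul_of_nonneg_left (hod0 u).2 hAL0) hβ) (le_refl (Real.sqrt β / 2))) hKL0
  have hBcb : ∀ _u : GaugeConfig 3 1 SU2, |KL * β * AL| ≤ KL * β * AL := fun _ => by rw [abs_of_nonneg (mul_nonneg (mul_nonneg hKL0 hβ) hAL0)]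
  have h1b : ∀ _u : GaugeConfig 3 1 SU2, |(1 : ℝ)| ≤ 1 := fun _ => by rw [abs_one]
  have h0b : ∀ _u : GaugeConfig 3 1 SU2, |(0 : ℝ)| ≤ 0 := fun _ => by rw [abs_zero]
  have hG₀m : Measurable G₀ := by rw [hG₀]; exact hGm hA₀m hB₀m
  have hG₁m : Measurable G₁ := by rw [hG₁]; exact hGm hA₁m measurable_const
  have hGRm : Measurable GR := by rw [hGR]; exact hGm measurable_const measurable_const
  have hG₀b : ∀ u, 0 ≤ G₀ u ∧ G₀ u ≤ ((216 * β * Γ * (4 * (Fintype.card (Edge 3 1) : ℝ)) ^ 2 + KL * (β * (AL * (4 * (Fintype.card (Edge 3 1) : ℝ))) + Real.sqrt β / 2) * sv + 3 * c₂ * sv ^ 2) +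
      (216 * β * Γ * (4 * (Fintype.card (Edge 3 1) : ℝ)) + KL * β * AL * sv) * (4 * (Fintype.card (Edge 3 1) : ℝ))) ^ 2 * (M / K1) := fun u => by
    rw [hG₀]; exact hGb hA₀b hB₀b u
  have hG₁b : ∀ u, 0 ≤ G₁ u ∧ G₁ u ≤ (KL * (β * (AL * (4 * (Fintype.card (Edge 3 1) : ℝ))) + Real.sqrt β / 2) + KL * β * AL * (4 * (Fintype.card (Edge 3 1) : ℝ))) ^ 2 * (M / K1) := fun u => by
    rw [hG₁]; exact hGb hA₁b hBcb u
  have hGRb : ∀ u, 0 ≤ GR u ∧ GR u ≤ ((1 : ℝ) + 0 * (4 * (Fintype.card (Edge 3 1) : ℝ))) ^ 2 * (M / K1) := fun u => by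
    rw [hGR]; exact hGb h1b h0b u
  have hWout : MeasurableSet {u : GaugeConfig 3 1 SU2 | orbitDist u ≤ dO} := measurableSet_le hodm measurable_const
  have hind : ∀ u, 0 ≤ {u : GaugeConfig 3 1 SU2 | orbitDist u ≤ dO}.indicator (fun _ => (1 : ℝ)) u ∧ {u : GaugeConfig 3 1 SU2 | orbitDist u ≤ dO}.indicator (fun _ => (1 : ℝ)) u ≤ 1 :=
    fun u => ⟨Set.indicator_nonneg (fun _ _ => zero_le_one) _, Set.indicator_le_self' (fun _ _ => zero_le_one) _⟩
  -- integrability of the three slow integrands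
  have hInt : ∀ {G : GaugeConfig 3 1 SU2 → ℝ} {CG : ℝ}, Measurable G → (∀ u, 0 ≤ G u ∧ G u ≤ CG) →
      Integrable (fun u => {u : GaugeConfig 3 1 SU2 | orbitDist u ≤ dO}.indicator (fun _ => (1 : ℝ)) u * (Af u * G u)) (configMeasure SU2 1) := by
    intro G CG hGm' hGb'
    refine integrable_of_measurable_abs_le _ ((measurable_const.indicator hWout).mul (hAfm.mul hGm')) (C := Cφ ^ 2 * (M / K1) * CG) fun u => ?_
    rw [abs_of_nonneg (mul_nonneg (hind u).1 (mul_nonneg (hAf0 u) (hGb' u).1))]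
    calc {u : GaugeConfig 3 1 SU2 | orbitDist u ≤ dO}.indicator (fun _ => (1 : ℝ)) u * (Af u * G u) ≤ 1 * (Af u * G u) :=
          mul_le_mul_of_nonneg_right (hind u).2 (mul_nonneg (hAf0 u) (hGb' u).1)
      _ ≤ Cφ ^ 2 * (M / K1) * CG := by rw [one_mul]; exact mul_le_mul (hAfb u) (hGb' u).2 (hGb' u).1 (mul_nonneg (sq_nonneg _) hMK)
  have hI₀ := hInt hG₀m hG₀b
  have hI₁ := hInt hG₁m hG₁b
  have hIR := hInt hGRm hGRb
  -- the three slow factors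
  have hF₀ := slow_factor_sq_weight_le (dO := dO) hB0 hm hφm hφb (A := A₀) (Bc := B₀)
    (αA := 3 / 2 * KL ^ 2 * β * sv ^ 2 + 27 * c₂ ^ 2 * sv ^ 4) (βA := 3 * (216 * β * Γ) ^ 2 * dO ^ 2 + 6 * KL ^ 2 * β ^ 2 * AL ^ 2 * sv ^ 2)
    (αB := 2 * KL ^ 2 * β ^ 2 * AL ^ 2 * sv ^ 2) (βB := 2 * (216 * β * Γ) ^ 2) (by positivity) (by positivity) (by positivity) (by positivity)
    (fun u hu => by rw [hA₀]; exact g0_windowA hβ (hod0 u).1 hu) (fun u _ => by rw [hB₀]; exact g0_windowB KL AL β Γ sv (orbitDist u))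
  have hF₁ := slow_factor_sq_weight_le (dO := dO) hB0 hm hφm hφb (A := A₁) (Bc := fun _ => KL * β * AL)
    (αA := KL ^ 2 * β / 2) (βA := 2 * KL ^ 2 * β ^ 2 * AL ^ 2) (αB := KL ^ 2 * β ^ 2 * AL ^ 2) (βB := 0) (by positivity) (by positivity) (by positivity) le_rfl
    (fun u _ => by rw [hA₁]; exact g1_window hβ) (fun u _ => by nlinarith [sq_nonneg (orbitDist u)])
  have hFR := slow_factor_sq_weight_le (dO := dO) hB0 hm hφm hφb (A := fun _ => (1 : ℝ)) (Bc := fun _ => (0 : ℝ))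
    (αA := 1) (βA := 0) (αB := 0) (βB := 0) zero_le_one le_rfl le_rfl le_rfl
    (fun u _ => by nlinarith [sq_nonneg (orbitDist u)]) (fun u _ => by nlinarith [sq_nonneg (orbitDist u)])
  rw [← hK1] at hF₀ hF₁ hFR
  have eAf : ∀ u, ∫ w, φ w ^ 2 * (avgKernel B u w / K1) ∂configMeasure SU2 1 = Af u := fun u => by rw [hAf]
  have eG₀' : ∀ u, ∫ w, (A₀ u + B₀ u * orbitDist w) ^ 2 * (avgKernel B u w / K1) ∂configMeasure SU2 1 = G₀ u := fun u => by rw [hG₀]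
  have eG₁' : ∀ u, ∫ w, (A₁ u + KL * β * AL * orbitDist w) ^ 2 * (avgKernel B u w / K1) ∂configMeasure SU2 1 = G₁ u := fun u => by rw [hG₁]
  have eGR' : ∀ u, ∫ w, ((1 : ℝ) + 0 * orbitDist w) ^ 2 * (avgKernel B u w / K1) ∂configMeasure SU2 1 = GR u := fun u => by rw [hGR]
  simp only [eAf, eG₀'] at hF₀
  simp only [eAf, eG₁'] at hF₁
  simp only [eAf, eGR'] at hFR
  -- the pointwise decomposition of the integrand and linearity
  have hdecomp : ∀ u, {u : GaugeConfig 3 1 SU2 | orbitDist u ≤ dO}.indicator (fun _ => (1 : ℝ)) u *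
      (Af u * (40 * (1 + ηc) * (G₀ u * Y₀ + G₁ u * (Y₁ + Y₂) + 9 * c₂ ^ 2 * GR u * (Y₃ + Y₄)) + 2 * ηc ^ 2 * Ef * GR u)) =
      40 * (1 + ηc) * Y₀ * ({u : GaugeConfig 3 1 SU2 | orbitDist u ≤ dO}.indicator (fun _ => (1 : ℝ)) u * (Af u * G₀ u)) +
        40 * (1 + ηc) * (Y₁ + Y₂) * ({u : GaugeConfig 3 1 SU2 | orbitDist u ≤ dO}.indicator (fun _ => (1 : ℝ)) u * (Af u * G₁ u)) +
        (40 * (1 + ηc) * (9 * c₂ ^ 2) * (Y₃ + Y₄) + 2 * ηc ^ 2 * Ef) * ({u : GaugeConfig 3 1 SU2 | orbitDist u ≤ dO}.indicator (fun _ => (1 : ℝ)) u * (Af u * GR u)) :=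
    fun u => by ring
  have hLHS : ∫ u, {u : GaugeConfig 3 1 SU2 | orbitDist u ≤ dO}.indicator (fun _ => (1 : ℝ)) u *
      (Af u * (40 * (1 + ηc) * (G₀ u * Y₀ + G₁ u * (Y₁ + Y₂) + 9 * c₂ ^ 2 * GR u * (Y₃ + Y₄)) + 2 * ηc ^ 2 * Ef * GR u)) ∂configMeasure SU2 1 =
      40 * (1 + ηc) * Y₀ * ∫ u, {u : GaugeConfig 3 1 SU2 | orbitDist u ≤ dO}.indicator (fun _ => (1 : ℝ)) u * (Af u * G₀ u) ∂configMeasure SU2 1 +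
        40 * (1 + ηc) * (Y₁ + Y₂) * ∫ u, {u : GaugeConfig 3 1 SU2 | orbitDist u ≤ dO}.indicator (fun _ => (1 : ℝ)) u * (Af u * G₁ u) ∂configMeasure SU2 1 +
        (40 * (1 + ηc) * (9 * c₂ ^ 2) * (Y₃ + Y₄) + 2 * ηc ^ 2 * Ef) *
          ∫ u, {u : GaugeConfig 3 1 SU2 | orbitDist u ≤ dO}.indicator (fun _ => (1 : ℝ)) u * (Af u * GR u) ∂configMeasure SU2 1 := by
    have hJ₀ : Integrable (fun u => 40 * (1 + ηc) * Y₀ * ({u : GaugeConfig 3 1 SU2 | orbitDist u ≤ dO}.indicator (fun _ => (1 : ℝ)) u * (Af u * G₀ u))) (configMeasure SU2 1) :=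
      hI₀.const_mul _
    have hJ₁ : Integrable (fun u => 40 * (1 + ηc) * (Y₁ + Y₂) * ({u : GaugeConfig 3 1 SU2 | orbitDist u ≤ dO}.indicator (fun _ => (1 : ℝ)) u * (Af u * G₁ u))) (configMeasure SU2 1) :=
      hI₁.const_mul _
    have hJR : Integrable (fun u => (40 * (1 + ηc) * (9 * c₂ ^ 2) * (Y₃ + Y₄) + 2 * ηc ^ 2 * Ef) *
        ({u : GaugeConfig 3 1 SU2 | orbitDist u ≤ dO}.indicator (fun _ => (1 : ℝ)) u * (Af u * GR u))) (configMeasure SU2 1) := hIR.const_mul _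
    have hJ₀₁ : Integrable (fun u => 40 * (1 + ηc) * Y₀ * ({u : GaugeConfig 3 1 SU2 | orbitDist u ≤ dO}.indicator (fun _ => (1 : ℝ)) u * (Af u * G₀ u)) +
        40 * (1 + ηc) * (Y₁ + Y₂) * ({u : GaugeConfig 3 1 SU2 | orbitDist u ≤ dO}.indicator (fun _ => (1 : ℝ)) u * (Af u * G₁ u))) (configMeasure SU2 1) := hJ₀.add hJ₁
    rw [integral_congr_ae (ae_of_all _ hdecomp), integral_add hJ₀₁ hJR, integral_add hJ₀ hJ₁, integral_const_mul, integral_const_mul, integral_const_mul]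
  -- fold the statement's integrand
  have hfold : ∀ u, {u : GaugeConfig 3 1 SU2 | orbitDist u ≤ dO}.indicator (fun _ => (1 : ℝ)) u *
      ((∫ w, φ w ^ 2 * (avgKernel B u w / K1) ∂configMeasure SU2 1) *
        (40 * (1 + ηc) *
            ((∫ w, (216 * β * (orbitDist u + orbitDist w) * orbitDist u * Γ + KL * (β * (AL * (orbitDist u + orbitDist w)) + Real.sqrt β / 2) * sv +
                3 * c₂ * sv ^ 2) ^ 2 * (avgKernel B u w / K1) ∂configMeasure SU2 1) * Y₀ +
              (∫ w, (KL * (β * (AL * (orbitDist u + orbitDist w)) + Real.sqrt β / 2)) ^ 2 * (avgKernel B u w / K1) ∂configMeasure SU2 1) * (Y₁ + Y₂) +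
              9 * c₂ ^ 2 * (∫ w, avgKernel B u w / K1 ∂configMeasure SU2 1) * (Y₃ + Y₄)) +
          2 * ηc ^ 2 * Ef * ∫ w, avgKernel B u w / K1 ∂configMeasure SU2 1)) =
      {u : GaugeConfig 3 1 SU2 | orbitDist u ≤ dO}.indicator (fun _ => (1 : ℝ)) u *
        (Af u * (40 * (1 + ηc) * (G₀ u * Y₀ + G₁ u * (Y₁ + Y₂) + 9 * c₂ ^ 2 * GR u * (Y₃ + Y₄)) + 2 * ηc ^ 2 * Ef * GR u)) := fun u => by
    rw [eG₀ u, eG₁ u, eGR u, hAf]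
  rw [integral_congr_ae (ae_of_all _ hfold), hLHS]
  -- combine
  have hc0 : 0 ≤ 40 * (1 + ηc) * Y₀ := mul_nonneg (mul_nonneg (by norm_num) (by linarith)) hY₀0
  have hc1 : 0 ≤ 40 * (1 + ηc) * (Y₁ + Y₂) := mul_nonneg (mul_nonneg (by norm_num) (by linarith)) (add_nonneg hY₁0 hY₂0)
  have hcR : 0 ≤ 40 * (1 + ηc) * (9 * c₂ ^ 2) * (Y₃ + Y₄) + 2 * ηc ^ 2 * Ef :=
    add_nonneg (mul_nonneg (mul_nonneg (mul_nonneg (by norm_num) (by linarith)) (by positivity)) (add_nonneg hY₃0 hY₄0)) (mul_nonneg (by positivity) hEf0)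
  have step := add_le_add (add_le_add (mul_le_mul_of_nonneg_left hF₀ hc0) (mul_le_mul_of_nonneg_left hF₁ hc1)) (mul_le_mul_of_nonneg_left hFR hcR)
  refine step.trans (le_of_eq ?_)
  ring

end Summit.QuantumFields.YangMills.Theorems.FemtoTransferGap.TwoLattice.ConstTube

end
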